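/-
Copyright (c) 2026. All rights reserved.
Released under Apache 2.0 license as described in the file LICENSE.
-/
import Literature.NumberTheory.GaloisRepresentations.LabelledWeightsKronecker
import HarnessLib

/-!
# Labelled Hodge–Tate weights of the dual: `HT_τ(ρ^∨) = −HT_τ(ρ)`

For a period-ring datum `𝔅` of `Γ` over `F/P` (period ring `B`, `B^Γ = F`) whose period ring is a
FIELD, a coefficient field `E ⊇ P` finite over `P` and containing the `[F:P]` embeddings of `F`, and a
framed representation `rE : Γ → GL_n(E)` such that `rE` and its contragredient `rE^∨ = (rE⁻¹)ᵀ`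
(`FramedRep.dual`) are `B`-admissible and satisfy the filtered comparison (`hcomp`, `hcomp'`; for
`B_dR` and `rE` de Rham both are the accepted `exists_basis_mem_filTensor_iff_of_isDeRham`, the dual
of a de Rham representation being de Rham by the accepted `FramedRep.IsDeRhamWith.dual`), this file
PROVES (no definition, no named fact, no `sorry`):

* `PeriodRingData.labelledHodgeTateWeights_dual` — **`HT_τ(rE^∨) = {−h : h ∈ HT_τ(rE)}`** as
  multisets, for every label `τ : F → E`.

## Proof

Write `R = E ⊗_P B` (a ring with the automorphisms `σ_R = 1 ⊗ σ`), `T = B ⊗_{F,τ} E` with its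
filtration `Fil^j T = Fil^j B ⊗ E` and the projection `p_τ : R → T` (accepted
`exists_ringHom_piTwist_one`), and `κ_i : Eⁿ ⊗ B → R` for the coordinate lines.  Choose bases
`(d_a)` of `D_τ(rE)` and `(d'_b)` of `D_τ(rE^∨)` adapted to the Hodge filtrations, with weights `h_a`,
`h'_b` (accepted `exists_basis_labelD_adapted`; both have `n` elements by the accepted
`finrank_labelD_eq_of_isAdmissible`), and let `C = (p_τ κ_i d_a)_{a,i}`, `C' = (p_τ κ_i d'_b)_{b,i}` be
the labelled period matrices, with inverses `A C = 1`, `A' C' = 1`, `A_{ia} ∈ Fil^{−h_a} T`,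
`A'_{ib} ∈ Fil^{−h'_b} T` (accepted `exists_matrix_mul_piTwist_eq_one`).

1. *The canonical pairing is invariant* (`map_sum_line_mul_line_of_mem_coeffD_dual`): for
   `x ∈ D(rE)`, `y ∈ D(rE^∨)` the element `s = Σ_i κ_i(x) κ_i(y) ∈ R` satisfies `σ_R(s) = s` — the
   matrix identity `(rE σ)⁻¹ (rE σ) = 1` read through `κ_i(σ·x) = Σ_j rE(σ)_{ij} σ_R(κ_j x)` (accepted
   `line_coeffTensorRep`) and `rE^∨(σ) = ((rE σ)⁻¹)ᵀ`.
2. *Invariants of `R` project to scalars of `T`* (`exists_piTwist_eq_twistScalar_of_forall_map_eq`):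
   an `s ∈ R` fixed by every `σ_R` lies in `D(𝟙)` for the trivial rank-one representation, whose
   label components `D_{τ'}(𝟙)` are LINES (Fontaine's count `dim_E D(𝟙) ≤ [F:P]`, each `D_{τ'}(𝟙)`
   containing the nonzero component `x_{τ'}` of `1 = Σ_{τ'} x_{τ'}`); so `s x_τ = e x_τ` with `e ∈ E`
   and `p_τ(s) = p_τ(s) p_τ(x_τ) = p_τ(e x_τ) = 1 ⊗ e`.
3. Hence `G = C C'ᵀ = (1 ⊗ g_{ab})` is a matrix of scalars with `G_{ab} ∈ Fil^{h_a + h'_b} T`, and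
   `A'ᵀ A` is its inverse, equal to `(1 ⊗ (g⁻¹)_{ba})` with `(A'ᵀ A)_{ba} ∈ Fil^{−h'_b − h_a} T`.  A
   nonzero scalar has filtration degree `≤ 0` (accepted `eq_zero_of_twistScalar_mem_twistFil`), so
   `g_{ab} ≠ 0 ⇒ h_a + h'_b ≤ 0` and `(g⁻¹)_{ba} ≠ 0 ⇒ h_a + h'_b ≥ 0`.
4. `det g ≠ 0 ≠ det g⁻¹` give permutations `π, π'` with `g_{π(i) i} ≠ 0`, `(g⁻¹)_{π'(i) i} ≠ 0`
   (`exists_perm_forall_apply_ne_zero_of_det_ne_zero`), i.e. `h_{π i} ≤ −h'_i` and `−h'_{π' i} ≤ h_i`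
   for all `i`; summing forces equality termwise, so `{h_a} = {−h'_b}` as multisets
   (`map_univ_val_eq_of_forall_perm_le`), and `HT_τ = {h_k}` in an adapted basis (accepted
   `labelledHodgeTateWeights_eq_map`).

## References
* [FontaineAsterisque223III] J.-M. Fontaine, *Représentations p-adiques semi-stables*, Astérisque 223
  (1994), Exp. III §1.5, Prop. 1.5.2 (`B`-admissible representations form a sub-tannakian category:
  `D_B` commutes with duals).
* [BrinonConrad2009] O. Brinon, B. Conrad, *CMI Summer School notes on p-adic Hodge theory* (2009),
  §6.3 (`D_dR` is exact and commutes with duals as a filtered functor).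
* [Patrikis2019] S. Patrikis, *Variations on a theorem of Tate*, Mem. AMS 258 (2019), §2.3.1
  (labelled Hodge–Tate weights).
* [Wach1996] N. Wach, Bull. SMF 124 (1996), §B.2.3, proof of Prop. 2 (p. 394) (adapted bases).
* [Lang1965Algebra] S. Lang, *Algebra*, Ch. XIII §4 (determinants), Ch. XVI (tensor products).
-/

noncomputable section

open scoped TensorProduct Matrix
open TensorProduct

namespace Literature.NumberTheory.GaloisRepresentations

universe u v v' w w'

-- Mathlib's own global value of `maxSynthPendingDepth` (see `LabelledWeightsTwist`); the tensor
-- types need a higher instance-synthesis budget.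
set_option maxSynthPendingDepth 3
set_option synthInstance.maxHeartbeats 200000

/-! ### 1. Matchings: permutations with nonvanishing diagonal; equal multisets from two dominations -/

section Matching

/-- **A matrix with nonzero determinant has a permutation `π` with all `G_{π(i), i} ≠ 0`** (one term
of the Leibniz expansion is nonzero). [cite: Lang1965Algebra, Ch. XIII §4 (expansion of the determinant)] -/
theorem exists_perm_forall_apply_ne_zero_of_det_ne_zero {R : Type*} [CommRing R] {m : ℕ}
    (G : Matrix (Fin m) (Fin m) R) (hG : G.det ≠ 0) :
    ∃ π : Equiv.Perm (Fin m), ∀ i, G (π i) i ≠ 0 := by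
  by_contra h
  push Not at h
  refine hG ?_
  rw [Matrix.det_apply]
  refine Finset.sum_eq_zero fun π _ => ?_
  obtain ⟨i, hi⟩ := h π
  rw [Finset.prod_eq_zero (f := fun j => G (π j) j) (Finset.mem_univ i) hi, smul_zero]

/-- **Two integer families dominating each other along permutations are equal as multisets**: if
`h (π i) ≤ k i` and `k (π' i) ≤ h i` for all `i`, then `{h_i} = {k_i}` (the sums agree, so every
inequality `h (π i) ≤ k i` is an equality). [cite: Lang1965Algebra, Ch. I §5 (permutations); elementary] -/
theorem map_univ_val_eq_of_forall_perm_le {m : ℕ} (h k : Fin m → ℤ) (π π' : Equiv.Perm (Fin m))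
    (h1 : ∀ i, h (π i) ≤ k i) (h2 : ∀ i, k (π' i) ≤ h i) :
    (Finset.univ : Finset (Fin m)).val.map h = (Finset.univ : Finset (Fin m)).val.map k := by
  have heq : ∑ i, h (π i) = ∑ i, k i := by
    refine le_antisymm (Finset.sum_le_sum fun i _ => h1 i) ?_
    rw [Equiv.sum_comp π h, ← Equiv.sum_comp π' k]
    exact Finset.sum_le_sum fun i _ => h2 i
  have hpt := (Finset.sum_eq_sum_iff_of_le fun i _ => h1 i).1 heq
  have hfun : k = h ∘ π := funext fun i => (hpt i (Finset.mem_univ i)).symm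
  rw [hfun, ← Multiset.map_map, ← Equiv.coe_toEmbedding, ← Finset.map_val, Finset.map_univ_equiv]

end Matching

namespace PeriodRingData

/-! ### 2. The canonical pairing `D(rE) × D(rE^∨) → R` is `Γ`-invariant -/

section Lines

variable {Γ : Type u} [Group Γ] [TopologicalSpace Γ] {P : Type v} {F : Type v'} [Field P] [Field F]
  [Algebra P F] {E : Type w} [Field E] [Algebra P E] [TopologicalSpace E] [IsTopologicalRing E]
  (𝔅 : PeriodRingData.{u, v, v', w'} Γ P F) {n : ℕ}
  (κ : Fin n → ((Fin n → E) ⊗[P] 𝔅.B →ₗ[E] (Fin 1 → E) ⊗[P] 𝔅.B))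
  (hκ : ∀ (j : Fin n) (v : Fin n → E) (b : 𝔅.B), κ j (v ⊗ₜ[P] b) = (fun _ : Fin 1 => v j) ⊗ₜ[P] b)
  (rE : FramedRep Γ E n) (σ : Γ)
  (φ : (Fin 1 → E) ⊗[P] 𝔅.B →ₐ[E] (Fin 1 → E) ⊗[P] 𝔅.B)
  (hφ : ∀ (c : Fin 1 → E) (b : 𝔅.B), φ (c ⊗ₜ[P] b) = c ⊗ₜ[P] (σ • b))

include hκ hφ in
/-- **The canonical pairing of `D(rE)` with `D(rE^∨)` is `Γ`-invariant.**  For `x ∈ D(rE)` and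
`y ∈ D(rE^∨)` (`rE^∨ = (rE⁻¹)ᵀ` the contragredient), the element `Σ_i κ_i(x) κ_i(y)` of `R = E ⊗_P B`
is fixed by `σ_R = 1 ⊗ σ`: with `u_i = κ_i x`, `w_i = κ_i y` one has `u = rE(σ) · σ_R(u)` and
`w = σ_R(w) · rE(σ)⁻¹`, so `Σ u_i w_i = σ_R(w) (rE(σ)⁻¹ rE(σ)) σ_R(u) = σ_R(Σ u_i w_i)`.
[cite: FontaineAsterisque223III, Exp. III §1.5, Prop. 1.5.2 (duals of admissible representations)] -/
theorem map_sum_line_mul_line_of_mem_coeffD_dual (x y : (Fin n → E) ⊗[P] 𝔅.B)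
    (hx : x ∈ 𝔅.coeffD (FramedRep.toContinuousRep rE))
    (hy : y ∈ 𝔅.coeffD (FramedRep.toContinuousRep rE.dual)) :
    φ (∑ i, κ i x * κ i y) = ∑ i, κ i x * κ i y := by
  classical
  set Rm : Matrix (Fin n) (Fin n) ((Fin 1 → E) ⊗[P] 𝔅.B) :=
    ((rE σ : GL (Fin n) E) : Matrix (Fin n) (Fin n) E).map
      (algebraMap E ((Fin 1 → E) ⊗[P] 𝔅.B)) with hRm
  set Rm' : Matrix (Fin n) (Fin n) ((Fin 1 → E) ⊗[P] 𝔅.B) :=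
    (((rE σ)⁻¹ : GL (Fin n) E) : Matrix (Fin n) (Fin n) E).map
      (algebraMap E ((Fin 1 → E) ⊗[P] 𝔅.B)) with hRm'
  have hinv : Rm' * Rm = 1 := by
    rw [hRm', hRm, ← Matrix.map_mul, ← Units.val_mul, inv_mul_cancel, Units.val_one,
      Matrix.map_one _ (map_zero _) (map_one _)]
  have hu : (fun i => κ i x) = Rm *ᵥ fun j => φ (κ j x) := by
    funext i
    have hxi : κ i x = κ i (𝔅.coeffTensorRep (FramedRep.toContinuousRep rE) σ x) := by
      rw [(𝔅.mem_coeffD_iff _ x).1 hx σ]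
    rw [hxi, 𝔅.line_coeffTensorRep κ hκ rE σ φ hφ x i]
    simp only [Matrix.mulVec, dotProduct, hRm, Matrix.map_apply, Algebra.smul_def]
  have hw : (fun i => κ i y) = (fun j => φ (κ j y)) ᵥ* Rm' := by
    funext i
    have hyi : κ i y = κ i (𝔅.coeffTensorRep (FramedRep.toContinuousRep rE.dual) σ y) := by
      rw [(𝔅.mem_coeffD_iff _ y).1 hy σ]
    rw [hyi, 𝔅.line_coeffTensorRep κ hκ rE.dual σ φ hφ y i]
    simp only [Matrix.vecMul, dotProduct, hRm', Matrix.map_apply, FramedRep.coe_dual_apply,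
      Matrix.transpose_apply, Algebra.smul_def]
    exact Finset.sum_congr rfl fun j _ => mul_comm _ _
  calc φ (∑ i, κ i x * κ i y) = (fun j => φ (κ j x)) ⬝ᵥ fun j => φ (κ j y) := by
        rw [map_sum, dotProduct]
        exact Finset.sum_congr rfl fun i _ => map_mul _ _ _
    _ = (fun j => φ (κ j y)) ⬝ᵥ fun j => φ (κ j x) := dotProduct_comm _ _
    _ = ((fun j => φ (κ j y)) ᵥ* (Rm' * Rm)) ⬝ᵥ fun j => φ (κ j x) := by
        rw [hinv, Matrix.vecMul_one]
    _ = (fun i => κ i y) ⬝ᵥ fun i => κ i x := by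
        rw [← Matrix.vecMul_vecMul, ← Matrix.dotProduct_mulVec, ← hu, ← hw]
    _ = ∑ i, κ i x * κ i y := by
        rw [dotProduct_comm]
        rfl

end Lines

/-! ### 3. `Γ`-invariants of `E ⊗_P B` project to scalars of `B ⊗_{F,τ} E` -/

section Scalars

variable {Γ : Type u} [Group Γ] [TopologicalSpace Γ] {P : Type v} {F : Type v'} [Field P] [Field F]
  [Algebra P F] [TopologicalSpace P] {E : Type w} [Field E] [Algebra P E] [TopologicalSpace E]
  [IsTopologicalRing E] (𝔅 : PeriodRingData.{u, v, v', w'} Γ P F) (τ : F →ₐ[P] E)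

/-- **`Γ`-invariants of `R = E ⊗_P B` project to scalars of `B ⊗_{F,τ} E`.**  For `E/P` finite
containing the `[F:P]` embeddings of `F/P` (finite separable): if `s ∈ R` is fixed by every
`σ_R = 1 ⊗ σ`, then `p_τ(s) = 1 ⊗ e` for some `e ∈ E`.  Indeed `s ∈ D(𝟙)` for the trivial rank-one
representation; `1 = Σ_{τ'} x_{τ'}` with `x_{τ'} ∈ D_{τ'}(𝟙)` nonzero (`p_{τ'}(x_{τ'}) = 1`), so by
Fontaine's count `dim_E D(𝟙) ≤ [F:P]` every `D_{τ'}(𝟙)` is a line; `s x_τ ∈ D_τ(𝟙) = E x_τ`, say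
`s x_τ = e x_τ`, and `p_τ(s) = p_τ(s) p_τ(x_τ) = p_τ(e x_τ) = 1 ⊗ e` (`p_τ(x_τ) = 1`).
[cite: FontaineAsterisque223III, Exp. III Prop. 1.4.2 and §1.5] [cite: Patrikis2019, §2.3.1] -/
theorem exists_piTwist_eq_twistScalar_of_forall_map_eq [FiniteDimensional P F]
    [Algebra.IsSeparable P F] [FiniteDimensional P E]
    (hsplit : Fintype.card (F →ₐ[P] E) = Module.finrank P F)
    (φ : Γ → ((Fin 1 → E) ⊗[P] 𝔅.B →ₐ[E] (Fin 1 → E) ⊗[P] 𝔅.B))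
    (hφ : ∀ (σ : Γ) (c : Fin 1 → E) (b : 𝔅.B), φ σ (c ⊗ₜ[P] b) = c ⊗ₜ[P] (σ • b))
    {s : (Fin 1 → E) ⊗[P] 𝔅.B} (hs : ∀ σ, φ σ s = s) :
    ∃ e : E, 𝔅.piTwist τ 1 s 0 = 𝔅.twistScalar τ e := by
  classical
  set ρ₀ := FramedRep.toContinuousRep ((FramedRep.scalar E 1).comp (1 : Γ →ₜ* Eˣ)) with hρ₀
  have hact : ∀ (σ : Γ) (y : (Fin 1 → E) ⊗[P] 𝔅.B), 𝔅.coeffTensorRep ρ₀ σ y = φ σ y :=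
    fun σ y => by
    rw [hρ₀, 𝔅.coeffTensorRep_scalar_comp σ (φ σ) (hφ σ)]
    simp only [ContinuousMonoidHom.coe_one, Pi.one_apply, Units.val_one, one_smul]
  have h1D : (1 : (Fin 1 → E) ⊗[P] 𝔅.B) ∈ 𝔅.coeffD ρ₀ :=
    (𝔅.mem_coeffD_iff ρ₀ _).2 fun σ => by rw [hact, map_one]
  -- the label components `x_{τ'}` of `1`
  obtain ⟨xl, hxl, hxlsum⟩ :=
    𝔅.exists_sum_labelFilD_eq ρ₀ hsplit h1D 𝔅.one_mem_coeffFilTensor_zero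
  have hxD : ∀ τ', xl τ' ∈ 𝔅.labelD ρ₀ τ'.toRingHom := fun τ' => (Submodule.mem_inf.1 (hxl τ')).1
  have hpx : ∀ τ' : F →ₐ[P] E, 𝔅.piTwist τ' 1 (xl τ') 0 = 1 := fun τ' => by
    have h1 : 𝔅.piTwist τ' 1 (∑ τ'', xl τ'') 0 = 1 := by
      rw [hxlsum, Algebra.TensorProduct.one_def, piTwist_tmul, Pi.one_apply, map_one,
        ← Algebra.TensorProduct.one_def]
    rw [map_sum, Finset.sum_apply, Finset.sum_eq_single τ' (fun τ'' _ hne => by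
      rw [𝔅.piTwist_eq_zero_of_mem_labelD ρ₀ τ' hne (hxD τ''), Pi.zero_apply])
      (fun h => absurd (Finset.mem_univ τ') h)] at h1
    exact h1
  have hx0 : ∀ τ' : F →ₐ[P] E, xl τ' ≠ 0 := fun τ' h0 => by
    have h := hpx τ'
    rw [h0, map_zero, Pi.zero_apply] at h
    exact zero_ne_one h
  -- Fontaine's count: every `D_{τ'}(𝟙)` is a line
  haveI : Module.Finite F (𝔅.D (ρ₀.restrictScalars P)) :=
    Module.rank_lt_aleph0_iff.1 ((𝔅.rank_D_le _).trans_lt Cardinal.natCast_lt_aleph0)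
  have hD : Module.finrank F (𝔅.D (ρ₀.restrictScalars P)) ≤ Module.finrank P (Fin 1 → E) :=
    𝔅.finrank_D_le_holds _
  obtain ⟨hfin, hle⟩ := 𝔅.finite_coeffD_and_finrank_le ρ₀ hD
  haveI := hfin
  haveI : ∀ τ' : F →ₐ[P] E, FiniteDimensional E (𝔅.labelD ρ₀ τ'.toRingHom) := fun τ' =>
    Submodule.finiteDimensional_of_le (𝔅.labelD_le_coeffD ρ₀ _)
  have hsum : Module.finrank E (𝔅.coeffD ρ₀) =
      ∑ τ' : F →ₐ[P] E, Module.finrank E (𝔅.labelD ρ₀ τ'.toRingHom) := by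
    rw [CoeffEigen.finrank_eq_sum_finrank_eigenSub (U := 𝔅.coeffD ρ₀) (𝔅.coeffDAct ρ₀) hsplit]
    exact Finset.sum_congr rfl fun τ' _ => 𝔅.finrank_eigenSub_coeffDAct ρ₀ τ'
  have hge : ∀ τ' : F →ₐ[P] E, 1 ≤ Module.finrank E (𝔅.labelD ρ₀ τ'.toRingHom) := fun τ' =>
    Module.finrank_pos_iff_exists_ne_zero.2
      ⟨⟨xl τ', hxD τ'⟩, fun h => hx0 τ' (congrArg Subtype.val h)⟩
  have h1 : Module.finrank E (𝔅.labelD ρ₀ τ.toRingHom) = 1 := by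
    refine CoeffEigen.eq_of_sum_le_of_le
      (d := fun τ' : F →ₐ[P] E => Module.finrank E (𝔅.labelD ρ₀ τ'.toRingHom)) ?_ hge τ
    rw [← hsum, hsplit]
    exact hle
  -- `s · x_τ ∈ D_τ(𝟙) = E · x_τ`
  have hsx : s * xl τ ∈ 𝔅.labelD ρ₀ τ.toRingHom := by
    refine (𝔅.mem_labelD_iff ρ₀ _ _).2 ⟨(𝔅.mem_coeffD_iff ρ₀ _).2 fun σ => ?_, fun f => ?_⟩
    · rw [hact, map_mul, hs, ← hact σ (xl τ),
        (𝔅.mem_coeffD_iff ρ₀ _).1 (𝔅.labelD_le_coeffD ρ₀ _ (hxD τ)) σ]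
    · rw [𝔅.baseAct_mul, ((𝔅.mem_labelD_iff ρ₀ _ _).1 (hxD τ)).2 f, mul_smul_comm]
  obtain ⟨e, he⟩ := (finrank_eq_one_iff_of_nonzero' (⟨xl τ, hxD τ⟩ : 𝔅.labelD ρ₀ τ.toRingHom)
    (fun h => hx0 τ (congrArg Subtype.val h))).1 h1 ⟨s * xl τ, hsx⟩
  have he' : s * xl τ = e • xl τ := by
    have h := congrArg Subtype.val he
    rw [Submodule.coe_smul] at h
    exact h.symm
  obtain ⟨p, hp⟩ := 𝔅.exists_ringHom_piTwist_one τ (E := E)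
  have hpx1 : p (xl τ) = 1 := by rw [hp]; exact hpx τ
  refine ⟨e, ?_⟩
  calc 𝔅.piTwist τ 1 s 0 = p s := (hp s).symm
    _ = p (s * xl τ) := by rw [map_mul, hpx1, mul_one]
    _ = 𝔅.twistScalar τ e := by
        rw [he', hp, 𝔅.piTwist_smul, Pi.smul_apply, ← hp, hpx1, smul_eq_mul, mul_one]

end Scalars

/-! ### 4. `HT_τ(rE^∨) = −HT_τ(rE)` -/

section Dual

variable {Γ : Type u} [Group Γ] [TopologicalSpace Γ] {P : Type v} {F : Type v'} [Field P] [Field F]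
  [Algebra P F] [TopologicalSpace P] {E : Type w} [Field E] [Algebra P E] [TopologicalSpace E]
  [IsTopologicalRing E] (𝔅 : PeriodRingData.{u, v, v', w'} Γ P F)

/-- **Labelled Hodge–Tate weights of the dual: `HT_τ(rE^∨) = −HT_τ(rE)`.**  For a period-ring datum
whose period ring is a field, `E/P` finite containing the `[F:P]` embeddings of `F`, and
`rE : Γ → GL_n(E)` such that `rE` and its contragredient `rE^∨ = (rE⁻¹)ᵀ` (`FramedRep.dual`) are
`B`-admissible and satisfy the filtered comparison (`hcomp`, `hcomp'`; for `B_dR` and `rE` de Rham these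
are the accepted `exists_basis_mem_filTensor_iff_of_isDeRham`, `FramedRep.IsDeRhamWith.dual`), the
labelled Hodge–Tate weights of `rE^∨` at every label `τ` are the negatives of those of `rE`:
the labelled period matrices `C`, `C'` of `D_τ(rE)`, `D_τ(rE^∨)` in adapted bases satisfy
`C C'ᵀ = (1 ⊗ g)` for an invertible SCALAR matrix `g` with `g_{ab} ∈ Fil^{h_a + h'_b}`,
`(g⁻¹)_{ba} ∈ Fil^{−h_a − h'_b}`, and nonzero scalars have filtration degree `≤ 0` — see the module
docstring. [cite: FontaineAsterisque223III, Exp. III §1.5, Prop. 1.5.2] [cite: BrinonConrad2009, §6.3] [cite: Patrikis2019, §2.3.1] -/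
theorem labelledHodgeTateWeights_dual (hB : IsField 𝔅.B) [FiniteDimensional P F]
    [Algebra.IsSeparable P F] [FiniteDimensional P E]
    (hsplit : Fintype.card (F →ₐ[P] E) = Module.finrank P F) {n : ℕ} (rE : FramedRep Γ E n)
    (hadm : 𝔅.IsAdmissible ((FramedRep.toContinuousRep rE).restrictScalars P))
    (hadm' : 𝔅.IsAdmissible ((FramedRep.toContinuousRep rE.dual).restrictScalars P))
    (hcomp : ∃ (ℓ : ℕ) (𝒷 : Module.Basis (Fin ℓ) 𝔅.B (𝔅.B ⊗[P] (Fin n → E))) (w : Fin ℓ → ℤ),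
      (∀ l, 𝒷 l ∈ 𝔅.D ((FramedRep.toContinuousRep rE).restrictScalars P)) ∧
      (∀ l, 𝒷 l ∈ 𝔅.filTensor (Fin n → E) (w l)) ∧
      ∀ (j : ℤ) (y : 𝔅.B ⊗[P] (Fin n → E)),
        y ∈ 𝔅.filTensor (Fin n → E) j ↔ ∀ l, 𝒷.repr y l ∈ 𝔅.fil (j - w l))
    (hcomp' : ∃ (ℓ : ℕ) (𝒷 : Module.Basis (Fin ℓ) 𝔅.B (𝔅.B ⊗[P] (Fin n → E))) (w : Fin ℓ → ℤ),
      (∀ l, 𝒷 l ∈ 𝔅.D ((FramedRep.toContinuousRep rE.dual).restrictScalars P)) ∧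
      (∀ l, 𝒷 l ∈ 𝔅.filTensor (Fin n → E) (w l)) ∧
      ∀ (j : ℤ) (y : 𝔅.B ⊗[P] (Fin n → E)),
        y ∈ 𝔅.filTensor (Fin n → E) j ↔ ∀ l, 𝒷.repr y l ∈ 𝔅.fil (j - w l))
    (τ : F →ₐ[P] E) :
    𝔅.labelledHodgeTateWeights (FramedRep.toContinuousRep rE.dual) τ.toRingHom =
      (𝔅.labelledHodgeTateWeights (FramedRep.toContinuousRep rE) τ.toRingHom).map fun w => -w := by
  classical
  -- adapted bases of `D_τ(rE)` and `D_τ(rE^∨)`, both indexed by `Fin n`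
  have hbasis : ∀ r : FramedRep Γ E n,
      𝔅.IsAdmissible ((FramedRep.toContinuousRep r).restrictScalars P) →
      ∃ (d : Module.Basis (Fin n) E (𝔅.labelD (FramedRep.toContinuousRep r) τ.toRingHom))
        (h : Fin n → ℤ),
        (∀ k, (d k : (Fin n → E) ⊗[P] 𝔅.B) ∈
          𝔅.labelFilD (FramedRep.toContinuousRep r) τ.toRingHom (h k)) ∧
        ∀ (i : ℤ) (v : 𝔅.labelD (FramedRep.toContinuousRep r) τ.toRingHom),
          (v : (Fin n → E) ⊗[P] 𝔅.B) ∈ 𝔅.labelFilD (FramedRep.toContinuousRep r) τ.toRingHom i ↔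
            ∀ k, d.repr v k ≠ 0 → i ≤ h k := fun r hr => by
    obtain ⟨hfinτ, hrank⟩ := 𝔅.finrank_labelD_eq_of_isAdmissible hB hsplit r hr τ
    haveI := hfinτ
    obtain ⟨m, d, h, hdh, hiff⟩ :=
      𝔅.exists_basis_labelD_adapted (FramedRep.toContinuousRep r) τ.toRingHom
    have hm : m = n := by rw [← hrank, Module.finrank_eq_card_basis d, Fintype.card_fin]
    subst hm
    exact ⟨d, h, hdh, hiff⟩
  obtain ⟨d, h, hdh, hiff⟩ := hbasis rE hadm
  obtain ⟨d', h', hdh', hiff'⟩ := hbasis rE.dual hadm'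
  -- the labelled period matrices and their inverses
  obtain ⟨A, hAC, hA⟩ :=
    𝔅.exists_matrix_mul_piTwist_eq_one τ (FramedRep.toContinuousRep rE) hsplit hcomp d h hiff
  obtain ⟨A', hA'C', hA'⟩ :=
    𝔅.exists_matrix_mul_piTwist_eq_one τ (FramedRep.toContinuousRep rE.dual) hsplit hcomp' d' h'
      hiff'
  set C : Matrix (Fin n) (Fin n) (𝔅.TwistRing τ) :=
    Matrix.of fun k i => 𝔅.piTwist τ n (d k : (Fin n → E) ⊗[P] 𝔅.B) i with hC
  set C' : Matrix (Fin n) (Fin n) (𝔅.TwistRing τ) :=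
    Matrix.of fun k i => 𝔅.piTwist τ n (d' k : (Fin n → E) ⊗[P] 𝔅.B) i with hC'
  have hCA : C * A = 1 := mul_eq_one_comm.1 hAC
  have hC'A' : C' * A' = 1 := mul_eq_one_comm.1 hA'C'
  -- coordinate lines, the ring automorphisms `σ_R = 1 ⊗ σ`, the projection `p_τ : R → T`
  let κ : Fin n → ((Fin n → E) ⊗[P] 𝔅.B →ₗ[E] (Fin 1 → E) ⊗[P] 𝔅.B) := fun j =>
    TensorProduct.AlgebraTensorModule.map
      (LinearMap.pi fun _ : Fin 1 => (LinearMap.proj j : (Fin n → E) →ₗ[E] E))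
      (LinearMap.id : 𝔅.B →ₗ[P] 𝔅.B)
  have hκ : ∀ (j : Fin n) (v : Fin n → E) (b : 𝔅.B),
      κ j (v ⊗ₜ[P] b) = (fun _ : Fin 1 => v j) ⊗ₜ[P] b := fun j v b => rfl
  let φ : Γ → ((Fin 1 → E) ⊗[P] 𝔅.B →ₐ[E] (Fin 1 → E) ⊗[P] 𝔅.B) := fun σ =>
    Algebra.TensorProduct.map (AlgHom.id E (Fin 1 → E)) (MulSemiringAction.toAlgHom P 𝔅.B σ)
  have hφ : ∀ (σ : Γ) (c : Fin 1 → E) (b : 𝔅.B), φ σ (c ⊗ₜ[P] b) = c ⊗ₜ[P] (σ • b) :=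
    fun σ c b => by
    simp only [φ, Algebra.TensorProduct.map_tmul, AlgHom.coe_id, id_eq,
      MulSemiringAction.toAlgHom_apply]
  obtain ⟨p, hp⟩ := 𝔅.exists_ringHom_piTwist_one τ (E := E)
  -- the invariant pairings `s_{ab} = Σ_i κ_i(d_a) κ_i(d'_b)` project to scalars `1 ⊗ g_{ab}`
  have hdD : ∀ a, (d a : (Fin n → E) ⊗[P] 𝔅.B) ∈ 𝔅.coeffD (FramedRep.toContinuousRep rE) :=
    fun a => 𝔅.labelD_le_coeffD _ _ (d a).2
  have hd'D : ∀ b, (d' b : (Fin n → E) ⊗[P] 𝔅.B) ∈ 𝔅.coeffD (FramedRep.toContinuousRep rE.dual) :=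
    fun b => 𝔅.labelD_le_coeffD _ _ (d' b).2
  have hg : ∀ a b, ∃ e : E,
      p (∑ i, κ i (d a : (Fin n → E) ⊗[P] 𝔅.B) * κ i (d' b : (Fin n → E) ⊗[P] 𝔅.B)) =
        𝔅.twistScalar τ e := fun a b => by
    rw [hp]
    exact 𝔅.exists_piTwist_eq_twistScalar_of_forall_map_eq τ hsplit φ hφ fun σ =>
      𝔅.map_sum_line_mul_line_of_mem_coeffD_dual κ hκ rE σ (φ σ) (hφ σ) _ _ (hdD a) (hd'D b)
  choose g hg using hg
  set gM : Matrix (Fin n) (Fin n) E := Matrix.of fun a b => g a b with hgM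
  -- `C C'ᵀ = (1 ⊗ g)`
  have hG : (𝔅.twistScalarHom τ).mapMatrix gM = C * C'.transpose := by
    ext a b
    rw [RingHom.mapMatrix_apply, Matrix.map_apply, hgM, Matrix.of_apply, twistScalarHom_apply, ← hg,
      map_sum, Matrix.mul_apply]
    refine Finset.sum_congr rfl fun i _ => ?_
    rw [map_mul, hp, hp, 𝔅.piTwist_line κ hκ τ (d a : (Fin n → E) ⊗[P] 𝔅.B) i,
      𝔅.piTwist_line κ hκ τ (d' b : (Fin n → E) ⊗[P] 𝔅.B) i, hC, hC', Matrix.transpose_apply,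
      Matrix.of_apply, Matrix.of_apply]
  -- `A'ᵀ A` is the inverse of `C C'ᵀ`
  have hGH : (𝔅.twistScalarHom τ).mapMatrix gM * (A'.transpose * A) = 1 := by
    rw [hG, Matrix.mul_assoc, ← Matrix.mul_assoc C'.transpose, ← Matrix.transpose_mul, hA'C',
      Matrix.transpose_one, Matrix.one_mul, hCA]
  have hHG : A'.transpose * A * (𝔅.twistScalarHom τ).mapMatrix gM = 1 := by
    rw [hG, Matrix.mul_assoc, ← Matrix.mul_assoc A, hAC, Matrix.one_mul, ← Matrix.transpose_mul,
      hC'A', Matrix.transpose_one]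
  -- `g` is invertible and `A'ᵀ A = (1 ⊗ g⁻¹)`
  have hdet : gM.det ≠ 0 := fun h0 => by
    have h1 : ((𝔅.twistScalarHom τ).mapMatrix gM * (A'.transpose * A)).det = 1 := by
      rw [hGH, Matrix.det_one]
    rw [Matrix.det_mul, ← RingHom.map_det, h0, map_zero, zero_mul] at h1
    exact zero_ne_one h1
  have hginv : gM * gM⁻¹ = 1 := Matrix.mul_nonsing_inv gM (isUnit_iff_ne_zero.2 hdet)
  have hHeq : A'.transpose * A = (𝔅.twistScalarHom τ).mapMatrix gM⁻¹ := by
    calc A'.transpose * A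
        = A'.transpose * A *
            ((𝔅.twistScalarHom τ).mapMatrix gM * (𝔅.twistScalarHom τ).mapMatrix gM⁻¹) := by
          rw [← map_mul, hginv, map_one, Matrix.mul_one]
      _ = (𝔅.twistScalarHom τ).mapMatrix gM⁻¹ := by rw [← Matrix.mul_assoc, hHG, Matrix.one_mul]
  -- filtration degrees of the entries
  have hCfil : ∀ a i, C a i ∈ LinearMap.range ((𝔅.fil (h a)).subtype.rTensor (TwistCoeff τ)) :=
    fun a i => by
    rw [hC, Matrix.of_apply]
    exact 𝔅.piTwist_apply_mem_twistFil τ (Submodule.mem_inf.1 (hdh a)).2 i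
  have hC'fil : ∀ b i, C' b i ∈ LinearMap.range ((𝔅.fil (h' b)).subtype.rTensor (TwistCoeff τ)) :=
    fun b i => by
    rw [hC', Matrix.of_apply]
    exact 𝔅.piTwist_apply_mem_twistFil τ (Submodule.mem_inf.1 (hdh' b)).2 i
  have hGfil : ∀ a b, 𝔅.twistScalar τ (g a b) ∈
      LinearMap.range ((𝔅.fil (h a + h' b)).subtype.rTensor (TwistCoeff τ)) := fun a b => by
    have hab : 𝔅.twistScalar τ (g a b) = (C * C'.transpose) a b := by
      rw [← hG, RingHom.mapMatrix_apply, Matrix.map_apply, hgM, Matrix.of_apply,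
        twistScalarHom_apply]
    rw [hab, Matrix.mul_apply]
    exact Submodule.sum_mem _ fun i _ =>
      𝔅.mul_mem_twistFil τ (hCfil a i) (by rw [Matrix.transpose_apply]; exact hC'fil b i)
  have hHfil : ∀ b a, 𝔅.twistScalar τ (gM⁻¹ b a) ∈
      LinearMap.range ((𝔅.fil (-h' b + -h a)).subtype.rTensor (TwistCoeff τ)) := fun b a => by
    have hba : 𝔅.twistScalar τ (gM⁻¹ b a) = (A'.transpose * A) b a := by
      rw [hHeq, RingHom.mapMatrix_apply, Matrix.map_apply, twistScalarHom_apply]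
    rw [hba, Matrix.mul_apply]
    exact Submodule.sum_mem _ fun i _ =>
      𝔅.mul_mem_twistFil τ (by rw [Matrix.transpose_apply]; exact hA' i b) (hA i a)
  -- nonzero scalars have filtration degree `≤ 0`
  have hle1 : ∀ a b, g a b ≠ 0 → h a + h' b ≤ 0 := fun a b hne => by
    by_contra hlt
    exact hne (𝔅.eq_zero_of_twistScalar_mem_twistFil τ (show 1 ≤ h a + h' b by omega) (hGfil a b))
  have hle2 : ∀ b a, gM⁻¹ b a ≠ 0 → 0 ≤ h a + h' b := fun b a hne => by
    by_contra hlt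
    exact hne (𝔅.eq_zero_of_twistScalar_mem_twistFil τ (show 1 ≤ -h' b + -h a by omega)
      (hHfil b a))
  -- permutations with nonvanishing diagonals, and the matching of the weights
  obtain ⟨π, hπ⟩ := exists_perm_forall_apply_ne_zero_of_det_ne_zero gM hdet
  have hdet' : gM⁻¹.det ≠ 0 := fun h0 => by
    have h1 := congrArg Matrix.det hginv
    rw [Matrix.det_mul, h0, mul_zero, Matrix.det_one] at h1
    exact zero_ne_one h1
  obtain ⟨π', hπ'⟩ := exists_perm_forall_apply_ne_zero_of_det_ne_zero gM⁻¹ hdet'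
  have hk : (Finset.univ : Finset (Fin n)).val.map h = Finset.univ.val.map fun i => -h' i :=
    map_univ_val_eq_of_forall_perm_le h (fun i => -h' i) π π'
      (fun i => by
        have hπi : g (π i) i ≠ 0 := by
          have h0 := hπ i
          rwa [hgM, Matrix.of_apply] at h0
        have := hle1 (π i) i hπi
        omega)
      (fun i => by
        have := hle2 (π' i) i (hπ' i)
        omega)
  rw [labelledHodgeTateWeights_eq_map d' h' hiff', labelledHodgeTateWeights_eq_map d h hiff, hk,
    Multiset.map_map]
  refine Multiset.map_congr rfl fun i _ => ?_
  simp only [Function.comp_apply, neg_neg]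

end Dual

end PeriodRingData

end Literature.NumberTheory.GaloisRepresentations

end
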